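import Summits.RiemannHypothesis.RiemannHypothesis.Theorems.PfPersistenceRealPairNegative
import Summits.RiemannHypothesis.RiemannHypothesis.Theorems.GroundBartaPolarPerronFrobeniusThetaQuasimode
import HarnessLib

/-!
# PF-persistence barrier: the planted real POLE pair, and TWO-PARITY MONOTONE walls
# (PROVED, RH-free, binder-free)

Framing (page 1 of every `pub-rhpf` file): **long-odds MECHANISM / RIGIDITY SEARCH — nothing here is
a claim about RH.**  Every statement below is RH-free; `RiemannHypothesis` is never a hypothesis or a
conclusion.

REALPAIR-MONO (`…BarrierRealPair`, made binder-free in `…RealPairNegative`) says: a criterion inherited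
UPWARD along EVEN-sector domination cannot tell `ζ` from `ζ` with a planted real pair of ZEROS
`{1/2 ± η}` — the pair RAISES the even block and LOWERS the odd block.  This file adds the MIRROR
control and the two mixed-parity walls.

* `polePairDatum η` — `ζ`'s explicit-formula datum with the real-pair term SUBTRACTED from the smooth
  part (a planted real pair of POLES at `1/2 ± η`): `Re Q = Re Q_ζ − 2‖ĝ(1/2+η)‖²` on EVEN tests and
  `Re Q_ζ + 2‖ĝ(1/2+η)‖²` on ODD tests (`polePairDatum_re_quadratic_of_isEven/IsOdd`); so `ζ`
  even-dominates it and it odd-dominates `ζ`.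
* **It is a NEGATIVE, provably** (every `η`, RH-free): the theta window vector `Θ_a`
  (`…GroundBartaPolarPerronFrobeniusThetaQuasimode`: `‖Q_ζ(Θ_a)‖ → 0` super-exponentially, while
  `‖Θ̂_a(1/2+η)‖ ≥ 2(min_{[-1,1]}Φ)e^{−|η|}`) has negative pole-pair energy at every large window:
  `eventually_not_evenPositivityOn_polePairDatum`, `not_evenRealPositivity_polePairDatum`,
  `not_positivity_polePairDatum`.
* TWO-PARITY MONOTONE CRITERIA: `IsEvenUpOddDownMonotone P` (inherited along "even block up, odd
  block down" — every even-monotone criterion, and mixed readers such as "the `(k+1)`-st even level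
  lies above the odd ground", `EvenAboveOddGroundOn`) transfer from `ζ` to `realPairDatum η`;
  `IsEvenDownOddUpMonotone P` (inherited along "even down, odd up" — every ODD-monotone criterion:
  odd floors `OddFloorOn`, odd window positivity; and the ORDER BIT "the bottom of the window is
  even", `EvenBottomOn`, weak or strict) transfer from `ζ` to `polePairDatum η`.
* WALLS (binder-free, negative class `⊇ {F | ¬ F.Positivity}`): `no_evenUpOddDown_discriminator`,
  `no_evenDownOddUp_discriminator`, `no_oddMonotone_discriminator`, and the instances
  `no_evenBottom_discriminator` (order bit on any window set), `no_evenStrictBottom_discriminator`,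
  `no_oddFloor_discriminator`, `no_evenAboveOddGround_discriminator`.

Reading for the cell (`CASE-DAG.md`): single-orientation parity readers — anything monotone under
raising one parity block while lowering the other — are blind to one of the two real-pair controls;
a discriminator must be NON-monotone in at least one parity block.  References: Bombieri 2000
(explicit formula, Thm 2); Weil 1952.
-/

set_option linter.dupNamespace false

noncomputable section

open Set MeasureTheory Filter Complex
open scoped Real Topology ComplexConjugate

namespace Summit.RiemannHypothesis.RiemannHypothesis.Theorems.PfPersistenceBarrier

open Literature.NumberTheory.LFunctions
open ExplicitDatum
open Summit.RiemannHypothesis.RiemannHypothesis.Theorems.PolarPerronFrobenius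

/-- The smooth plateau cut-off `χ_a` of `…GroundBartaPolarPerronFrobeniusThetaWindowTest`. -/
local notation "χ[" a "]" => (fun t : ℝ =>
  Real.smoothTransition ((a - t) * Real.exp (2 * a)) * Real.smoothTransition ((a + t) * Real.exp (2 * a)))

/-- The smooth theta window vector `Θ_a = Φ χ_a`, complexified (same spelling as the route files). -/
local notation "Θ[" a "]" => (fun t : ℝ =>
  ((weilThetaPhi t * Real.smoothTransition ((a - t) * Real.exp (2 * a)) *
    Real.smoothTransition ((a + t) * Real.exp (2 * a)) : ℝ) : ℂ))

/-! ## The planted real POLE pair as an explicit-formula datum -/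

/-- `ζ` WITH A PLANTED REAL PAIR OF POLES `{1/2 ± η}`: same point masses as `zetaDatum`, smooth part
DIMINISHED by `realPairTerm η` (the mirror of `realPairDatum`). [folklore] -/
def polePairDatum (η : ℝ) : ExplicitDatum where
  smooth k := zetaDatum.smooth k - realPairTerm η k
  pos := zetaDatum.pos
  wt := zetaDatum.wt

/-- `Q_pole(g) = Q_ζ(g) − realPairTerm η (g ⋆ g̃)`. [folklore] -/
theorem polePairDatum_quadratic (η : ℝ) (g : ℝ → ℂ) :
    (polePairDatum η).quadratic g =
      zetaDatum.quadratic g - realPairTerm η (weilConv g (weilReflect g)) := by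
  simp only [ExplicitDatum.quadratic, ExplicitDatum.functional, ExplicitDatum.primeTerm, polePairDatum]
  ring

/-- EVEN tests: `Re Q_pole(g) = Re Q_ζ(g) − 2‖ĝ(1/2+η)‖²`. [folklore] -/
theorem polePairDatum_re_quadratic_of_isEven {g : ℝ → ℂ} (hg : IsWeilTest g) (he : IsEven g)
    (η : ℝ) : ((polePairDatum η).quadratic g).re =
      (zetaDatum.quadratic g).re - 2 * ‖weilMellin g ((1 / 2 + η : ℝ) : ℂ)‖ ^ 2 := by
  rw [polePairDatum_quadratic, realPairTerm_of_isEven hg he, Complex.sub_re, Complex.ofReal_re]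

/-- ODD tests: `Re Q_pole(g) = Re Q_ζ(g) + 2‖ĝ(1/2+η)‖²`. [folklore] -/
theorem polePairDatum_re_quadratic_of_isOdd {g : ℝ → ℂ} (hg : IsWeilTest g) (ho : IsOdd g)
    (η : ℝ) : ((polePairDatum η).quadratic g).re =
      (zetaDatum.quadratic g).re + 2 * ‖weilMellin g ((1 / 2 + η : ℝ) : ℂ)‖ ^ 2 := by
  rw [polePairDatum_quadratic, realPairTerm_of_isOdd hg ho, Complex.sub_re, Complex.neg_re,
    Complex.ofReal_re]
  ring

/-- `ζ` DOMINATES the pole pair in the even sector. [folklore] -/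
theorem polePairDatum_evenDominated (η : ℝ) : (polePairDatum η).EvenDominates zetaDatum := by
  intro g hg he
  rw [polePairDatum_re_quadratic_of_isEven hg he]
  have : 0 ≤ 2 * ‖weilMellin g ((1 / 2 + η : ℝ) : ℂ)‖ ^ 2 := by positivity
  linarith

/-- The pole pair DOMINATES `ζ` in the odd sector. [folklore] -/
theorem zetaDatum_oddDominates_polePairDatum (η : ℝ) : zetaDatum.OddDominates (polePairDatum η) := by
  intro g hg ho
  rw [polePairDatum_re_quadratic_of_isOdd hg ho]
  have : 0 ≤ 2 * ‖weilMellin g ((1 / 2 + η : ℝ) : ℂ)‖ ^ 2 := by positivity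
  linarith

/-! ## The pole pair is a negative: even energy of the theta window vector -/

/-- **`‖Θ̂_a(1/2+η)‖ ≥ m e^{-|η|}` uniformly in `a ≥ 2`** (`Θ_a ≥ 0`, `Θ_a = Φ` on `[-1, 1]`). [folklore] -/
theorem exists_norm_weilMellin_thetaWin_ge :
    ∃ m : ℝ, 0 < m ∧ ∀ η a : ℝ, 2 ≤ a →
      m * Real.exp (-|η|) ≤ ‖weilMellin Θ[a] ((1 / 2 + η : ℝ) : ℂ)‖ := by
  obtain ⟨t₀, -, hmin⟩ := (isCompact_Icc : IsCompact (Icc (-1 : ℝ) 1)).exists_isMinOn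
    (nonempty_Icc.2 (by norm_num)) continuous_weilThetaPhi.continuousOn
  refine ⟨2 * weilThetaPhi t₀, by positivity [weilThetaPhi_pos t₀], fun η a ha => ?_⟩
  set r : ℝ → ℝ := fun t => weilThetaPhi t * χ[a] t with hr
  have he : Θ[a] = fun t => ((r t : ℝ) : ℂ) := funext (thetaWin_apply a)
  have hc : Continuous r := continuous_weilThetaPhi.mul (thetaWin_cutoff_contDiff a).continuous
  have hs : HasCompactSupport r := (thetaWin_cutoff_hasCompactSupport a).mul_left
  have h0 : ∀ t, 0 ≤ r t := fun t =>
    mul_nonneg (weilThetaPhi_pos t).le (thetaWin_cutoff_nonneg_le_one a t).1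
  have hm : ∀ t ∈ Icc (-1 : ℝ) 1, weilThetaPhi t₀ ≤ r t := by
    intro t ht
    have h4 : Real.exp (-(2 * a)) ≤ 1 := by rw [Real.exp_le_one_iff]; linarith
    have h1 : χ[a] t = 1 := thetaWin_cutoff_eq_one (by
      have := abs_le.2 ⟨ht.1, ht.2⟩
      linarith)
    have h2 : r t = weilThetaPhi t := by simp only [hr, h1, mul_one]
    rw [h2]
    exact hmin ht
  rw [he, mul_assoc, ← mul_assoc]
  exact norm_weilMellin_ofReal_half_add_ge hc hs h0 hm η

/-- **`‖Q_ζ(Θ_a)‖ → 0`** as the window grows (from `norm_weilQuadratic_thetaWin_le`; RH-free). [folklore] -/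
theorem tendsto_norm_weilQuadratic_thetaWin :
    Tendsto (fun a : ℝ => ‖weilQuadratic Θ[a]‖) atTop (𝓝 0) := by
  obtain ⟨C, hC, hQ⟩ := norm_weilQuadratic_thetaWin_le
  set p : ℝ := 9 / 4 + (2 * π - 9 / 2) with hp
  have hΦ0 : 0 ≤ weilThetaPhi 0 := (weilThetaPhi_pos 0).le
  have hV : Tendsto (fun x : ℝ => x ^ (1 + p) * Real.exp (-π * x)) atTop (𝓝 0) :=
    tendsto_rpow_mul_exp_neg_mul_atTop_nhds_zero (1 + p) π Real.pi_pos
  have hx : Tendsto (fun a : ℝ => Real.exp (2 * a)) atTop atTop :=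
    Real.tendsto_exp_atTop.comp (tendsto_id.const_mul_atTop two_pos)
  have hW : Tendsto (fun a : ℝ => 2 * weilThetaPhi 0 * C *
      (Real.exp (2 * a) ^ (1 + p) * Real.exp (-π * Real.exp (2 * a)))) atTop (𝓝 0) := by
    simpa using (hV.comp hx).const_mul (2 * weilThetaPhi 0 * C)
  refine squeeze_zero' (Eventually.of_forall fun a => norm_nonneg _) ?_ hW
  filter_upwards [eventually_ge_atTop (2 : ℝ)] with a ha
  have hx0 : 0 < Real.exp (2 * a) := Real.exp_pos _
  have hax : a ≤ Real.exp (2 * a) := by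
    have := Real.add_one_le_exp (2 * a)
    linarith
  have hB : 0 ≤ C * Real.exp (2 * a) ^ p * Real.exp (-(π * Real.exp (2 * a))) := by positivity
  calc ‖weilQuadratic Θ[a]‖
      ≤ 2 * a * weilThetaPhi 0 * (C * Real.exp (2 * a) ^ p * Real.exp (-(π * Real.exp (2 * a)))) :=
        hQ a ha
    _ ≤ 2 * Real.exp (2 * a) * weilThetaPhi 0 *
          (C * Real.exp (2 * a) ^ p * Real.exp (-(π * Real.exp (2 * a)))) := by
        gcongr
    _ = 2 * weilThetaPhi 0 * C * (Real.exp (2 * a) ^ (1 + p) * Real.exp (-π * Real.exp (2 * a))) := by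
        rw [Real.rpow_add hx0 1 p, Real.rpow_one, neg_mul]
        ring

/-- **The theta window vector has NEGATIVE pole-pair energy at every large window** (every `η`):
`Re Q_pole(Θ_a) = Re Q_ζ(Θ_a) − 2‖Θ̂_a(1/2+η)‖² ≤ ‖Q_ζ(Θ_a)‖ − 2m²e^{−2|η|} < 0` eventually. [folklore] -/
theorem eventually_re_quadratic_polePairDatum_thetaWin_neg (η : ℝ) :
    ∀ᶠ a : ℝ in atTop, ((polePairDatum η).quadratic Θ[a]).re < 0 := by
  obtain ⟨m, hm, hM⟩ := exists_norm_weilMellin_thetaWin_ge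
  set κ : ℝ := 2 * (m * Real.exp (-|η|)) ^ 2 with hκdef
  have hκ : 0 < κ := by positivity
  filter_upwards [eventually_ge_atTop (2 : ℝ),
    tendsto_norm_weilQuadratic_thetaWin.eventually (gt_mem_nhds hκ)] with a ha hlt
  rw [polePairDatum_re_quadratic_of_isEven (thetaWin_isWeilTest a) (thetaWin_even a),
    zetaDatum_quadratic]
  have h1 : (weilQuadratic Θ[a]).re ≤ ‖weilQuadratic Θ[a]‖ := Complex.re_le_norm _
  have h2 : κ ≤ 2 * ‖weilMellin Θ[a] ((1 / 2 + η : ℝ) : ℂ)‖ ^ 2 := by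
    have h3 := hM η a ha
    have h4 : 0 ≤ m * Real.exp (-|η|) := by positivity
    rw [hκdef]
    nlinarith [h3, h4]
  linarith

/-- **At every large window an EVEN, REAL test of the window has negative pole-pair energy.** [folklore] -/
theorem eventually_exists_even_re_quadratic_polePairDatum_neg (η : ℝ) :
    ∀ᶠ a : ℝ in atTop, ∃ g : ℝ → ℂ, IsWeilTest g ∧ IsEven g ∧ (∀ t, (g t).im = 0) ∧
      tsupport g ⊆ Icc (-a) a ∧ ((polePairDatum η).quadratic g).re < 0 := by
  filter_upwards [eventually_re_quadratic_polePairDatum_thetaWin_neg η] with a ha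
  exact ⟨Θ[a], thetaWin_isWeilTest a, thetaWin_even a, thetaWin_im a, thetaWin_tsupport a, ha⟩

/-- Even window positivity of the pole pair FAILS at every large cutoff. [folklore] -/
theorem eventually_not_evenPositivityOn_polePairDatum (η : ℝ) :
    ∀ᶠ a : ℝ in atTop, ¬ (polePairDatum η).EvenPositivityOn a := by
  filter_upwards [eventually_exists_even_re_quadratic_polePairDatum_neg η] with a ha hpos
  obtain ⟨g, hg, he, -, hsupp, hneg⟩ := ha
  exact absurd (hpos g hg he hsupp) (not_le.2 hneg)

/-- The pole pair FAILS the even real-test criterion. [folklore] -/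
theorem not_evenRealPositivity_polePairDatum (η : ℝ) : ¬ (polePairDatum η).EvenRealPositivity := by
  intro hpos
  obtain ⟨a, g, hg, he, him, -, hneg⟩ :=
    (eventually_exists_even_re_quadratic_polePairDatum_neg η).exists
  exact absurd (hpos g hg he him) (not_le.2 hneg)

/-- **THE PLANTED REAL POLE PAIR IS NOT WEIL-POSITIVE (PROVED, RH-free)**, for every `η`. [folklore] -/
theorem not_positivity_polePairDatum (η : ℝ) : ¬ (polePairDatum η).Positivity := by
  intro hpos
  obtain ⟨a, g, hg, -, -, -, hneg⟩ :=
    (eventually_exists_even_re_quadratic_polePairDatum_neg η).exists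
  exact absurd (hpos g hg) (not_le.2 hneg)

/-- The pole pair lies in the canonical negative class. [folklore] -/
theorem polePairDatum_mem_not_positivity (η : ℝ) :
    polePairDatum η ∈ {F : ExplicitDatum | ¬ F.Positivity} :=
  not_positivity_polePairDatum η

/-! ## Two-parity monotone criteria -/

/-- Inherited along ODD-sector domination (odd window positivity, odd floors, odd sub-index criteria). [folklore] -/
def IsOddMonotone (P : ExplicitDatum → Prop) : Prop :=
  ∀ F G : ExplicitDatum, F.OddDominates G → P F → P G

/-- Inherited along "EVEN block UP, ODD block DOWN". [folklore] -/
def IsEvenUpOddDownMonotone (P : ExplicitDatum → Prop) : Prop :=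
  ∀ F G : ExplicitDatum, F.EvenDominates G → G.OddDominates F → P F → P G

/-- Inherited along "EVEN block DOWN, ODD block UP". [folklore] -/
def IsEvenDownOddUpMonotone (P : ExplicitDatum → Prop) : Prop :=
  ∀ F G : ExplicitDatum, G.EvenDominates F → F.OddDominates G → P F → P G

/-- Even-monotone criteria are (even up, odd down)-monotone. [folklore] -/
theorem IsEvenMonotone.isEvenUpOddDownMonotone {P : ExplicitDatum → Prop} (hP : IsEvenMonotone P) :
    IsEvenUpOddDownMonotone P :=
  fun F G hFG _ hF ↦ hP F G hFG hF

/-- Odd-monotone criteria are (even down, odd up)-monotone. [folklore] -/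
theorem IsOddMonotone.isEvenDownOddUpMonotone {P : ExplicitDatum → Prop} (hP : IsOddMonotone P) :
    IsEvenDownOddUpMonotone P :=
  fun F G _ hFG hF ↦ hP F G hFG hF

/-- Closure under conjunction. [folklore] -/
theorem IsEvenUpOddDownMonotone.and {P P' : ExplicitDatum → Prop} (hP : IsEvenUpOddDownMonotone P)
    (hP' : IsEvenUpOddDownMonotone P') : IsEvenUpOddDownMonotone fun F ↦ P F ∧ P' F :=
  fun F G h₁ h₂ hF ↦ ⟨hP F G h₁ h₂ hF.1, hP' F G h₁ h₂ hF.2⟩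

/-- Closure under arbitrary intersections (families over cutoffs / window sets). [folklore] -/
theorem IsEvenUpOddDownMonotone.all {ι : Sort*} {P : ι → ExplicitDatum → Prop}
    (hP : ∀ i, IsEvenUpOddDownMonotone (P i)) : IsEvenUpOddDownMonotone fun F ↦ ∀ i, P i F :=
  fun F G h₁ h₂ hF i ↦ hP i F G h₁ h₂ (hF i)

/-- Closure under conjunction. [folklore] -/
theorem IsEvenDownOddUpMonotone.and {P P' : ExplicitDatum → Prop} (hP : IsEvenDownOddUpMonotone P)
    (hP' : IsEvenDownOddUpMonotone P') : IsEvenDownOddUpMonotone fun F ↦ P F ∧ P' F :=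
  fun F G h₁ h₂ hF ↦ ⟨hP F G h₁ h₂ hF.1, hP' F G h₁ h₂ hF.2⟩

/-- Closure under arbitrary intersections. [folklore] -/
theorem IsEvenDownOddUpMonotone.all {ι : Sort*} {P : ι → ExplicitDatum → Prop}
    (hP : ∀ i, IsEvenDownOddUpMonotone (P i)) : IsEvenDownOddUpMonotone fun F ↦ ∀ i, P i F :=
  fun F G h₁ h₂ hF i ↦ hP i F G h₁ h₂ (hF i)

/-- **PROVED**: (even up, odd down)-monotone criteria transfer from `ζ` to every planted real ZERO pair. [folklore] -/
theorem realPair_of_isEvenUpOddDownMonotone {P : ExplicitDatum → Prop}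
    (hP : IsEvenUpOddDownMonotone P) (hζ : P zetaDatum) (η : ℝ) : P (realPairDatum η) :=
  hP _ _ (zetaDatum_evenDominates_realPairDatum η) (realPairDatum_oddDominated η) hζ

/-- **PROVED**: (even down, odd up)-monotone criteria transfer from `ζ` to every planted real POLE pair. [folklore] -/
theorem polePair_of_isEvenDownOddUpMonotone {P : ExplicitDatum → Prop}
    (hP : IsEvenDownOddUpMonotone P) (hζ : P zetaDatum) (η : ℝ) : P (polePairDatum η) :=
  hP _ _ (polePairDatum_evenDominated η) (zetaDatum_oddDominates_polePairDatum η) hζ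

/-! ## The two-parity walls (binder-free) -/

/-- **WALL EO (PROVED, RH-free, binder-free)**: no (even up, odd down)-monotone criterion discriminates
`ζ` from a negative class containing the non-Weil-positive data. [folklore] -/
theorem no_evenUpOddDown_discriminator {P : ExplicitDatum → Prop} (hP : IsEvenUpOddDownMonotone P)
    {Neg : Set ExplicitDatum} (hNeg : {F : ExplicitDatum | ¬ F.Positivity} ⊆ Neg) :
    ¬ Discriminates P zetaDatum Neg :=
  fun h ↦ h.2 _ (hNeg (realPairDatum_mem_not_positivity one_ne_zero))
    (realPair_of_isEvenUpOddDownMonotone hP h.1 1)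

/-- **WALL OE (PROVED, RH-free, binder-free)**: no (even down, odd up)-monotone criterion discriminates
`ζ` from a negative class containing the non-Weil-positive data. [folklore] -/
theorem no_evenDownOddUp_discriminator {P : ExplicitDatum → Prop} (hP : IsEvenDownOddUpMonotone P)
    {Neg : Set ExplicitDatum} (hNeg : {F : ExplicitDatum | ¬ F.Positivity} ⊆ Neg) :
    ¬ Discriminates P zetaDatum Neg :=
  fun h ↦ h.2 _ (hNeg (polePairDatum_mem_not_positivity 1)) (polePair_of_isEvenDownOddUpMonotone hP h.1 1)

/-- **WALL (odd sector alone)**: no odd-monotone criterion discriminates `ζ` from such a class. [folklore] -/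
theorem no_oddMonotone_discriminator {P : ExplicitDatum → Prop} (hP : IsOddMonotone P)
    {Neg : Set ExplicitDatum} (hNeg : {F : ExplicitDatum | ¬ F.Positivity} ⊆ Neg) :
    ¬ Discriminates P zetaDatum Neg :=
  no_evenDownOddUp_discriminator hP.isEvenDownOddUpMonotone hNeg

/-! ## Typed reader classes -/

namespace ExplicitDatum

/-- ORDER BIT "the bottom of the window `[-A, A]` is EVEN" (weak form `ε₁^ev ≤ ε₁^odd`): every odd test
of the window is matched, up to any `δ > 0`, by an even test of the same window and `L²`-mass with no
larger energy. [folklore] -/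
def EvenBottomOn (F : ExplicitDatum) (A : ℝ) : Prop :=
  ∀ o : ℝ → ℂ, IsWeilTest o → IsOdd o → tsupport o ⊆ Icc (-A) A → ∀ δ : ℝ, 0 < δ →
    ∃ e : ℝ → ℂ, IsWeilTest e ∧ IsEven e ∧ tsupport e ⊆ Icc (-A) A ∧
      (∫ t, ‖e t‖ ^ 2) = (∫ t, ‖o t‖ ^ 2) ∧ (F.quadratic e).re ≤ (F.quadratic o).re + δ

/-- STRICT ORDER BIT `ε₁^ev < ε₁^odd` (attained form): some even test of the window beats, by a fixed
margin `μ > 0`, every odd test of the window of the same `L²`-mass. [folklore] -/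
def EvenStrictBottomOn (F : ExplicitDatum) (A : ℝ) : Prop :=
  ∃ e : ℝ → ℂ, IsWeilTest e ∧ IsEven e ∧ tsupport e ⊆ Icc (-A) A ∧ ∃ μ : ℝ, 0 < μ ∧
    ∀ o : ℝ → ℂ, IsWeilTest o → IsOdd o → tsupport o ⊆ Icc (-A) A →
      (∫ t, ‖o t‖ ^ 2) = (∫ t, ‖e t‖ ^ 2) → (F.quadratic e).re + μ ≤ (F.quadratic o).re

/-- ODD FLOOR `ε₁^odd(A) ≥ σ`: `Re Q_F(o) ≥ σ‖o‖₂²` on odd tests of the window. [folklore] -/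
def OddFloorOn (F : ExplicitDatum) (σ A : ℝ) : Prop :=
  ∀ o : ℝ → ℂ, IsWeilTest o → IsOdd o → tsupport o ⊆ Icc (-A) A →
    σ * (∫ t, ‖o t‖ ^ 2) ≤ (F.quadratic o).re

/-- "THE `(k+1)`-ST EVEN LEVEL LIES ABOVE THE ODD GROUND" (`ε_{k+1}^ev ≥ ε₁^odd`, Courant form): on
some codimension-`k` subspace of the even tests of the window, every even test is matched up to any
`δ > 0` by an odd test of the same window and mass with no larger energy. [folklore] -/
def EvenAboveOddGroundOn (k : ℕ) (F : ExplicitDatum) (A : ℝ) : Prop :=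
  ∃ ℓ : Fin k → ((ℝ → ℂ) →ₗ[ℂ] ℂ), ∀ e : ℝ → ℂ, IsWeilTest e → IsEven e →
    tsupport e ⊆ Icc (-A) A → (∀ i, ℓ i e = 0) → ∀ δ : ℝ, 0 < δ →
      ∃ o : ℝ → ℂ, IsWeilTest o ∧ IsOdd o ∧ tsupport o ⊆ Icc (-A) A ∧
        (∫ t, ‖o t‖ ^ 2) = (∫ t, ‖e t‖ ^ 2) ∧ (F.quadratic o).re ≤ (F.quadratic e).re + δ

end ExplicitDatum

/-- The order bit is (even down, odd up)-monotone. [folklore] -/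
theorem evenBottomOn_isEvenDownOddUpMonotone (A : ℝ) :
    IsEvenDownOddUpMonotone fun F ↦ F.EvenBottomOn A := by
  intro F G hGF hFG hF o ho hodd hsupp δ hδ
  obtain ⟨e, he, hev, hse, hmass, hle⟩ := hF o ho hodd hsupp δ hδ
  exact ⟨e, he, hev, hse, hmass,
    (hGF e he hev).trans (hle.trans (by linarith [hFG o ho hodd]))⟩

/-- The strict order bit is (even down, odd up)-monotone. [folklore] -/
theorem evenStrictBottomOn_isEvenDownOddUpMonotone (A : ℝ) :
    IsEvenDownOddUpMonotone fun F ↦ F.EvenStrictBottomOn A := by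
  intro F G hGF hFG hF
  obtain ⟨e, he, hev, hse, μ, hμ, hgap⟩ := hF
  refine ⟨e, he, hev, hse, μ, hμ, fun o ho hodd hsupp hmass ↦ ?_⟩
  linarith [hGF e he hev, hgap o ho hodd hsupp hmass, hFG o ho hodd]

/-- Odd floors are odd-monotone. [folklore] -/
theorem oddFloorOn_isOddMonotone (σ A : ℝ) : IsOddMonotone fun F ↦ F.OddFloorOn σ A :=
  fun _ _ hFG hF o ho hodd hsupp ↦ (hF o ho hodd hsupp).trans (hFG o ho hodd)

/-- "Even level `k+1` above the odd ground" is (even up, odd down)-monotone. [folklore] -/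
theorem evenAboveOddGroundOn_isEvenUpOddDownMonotone (k : ℕ) (A : ℝ) :
    IsEvenUpOddDownMonotone fun F ↦ F.EvenAboveOddGroundOn k A := by
  intro F G hFG hGF hF
  obtain ⟨ℓ, hℓ⟩ := hF
  refine ⟨ℓ, fun e he hev hse hann δ hδ ↦ ?_⟩
  obtain ⟨o, ho, hodd, hso, hmass, hle⟩ := hℓ e he hev hse hann δ hδ
  exact ⟨o, ho, hodd, hso, hmass,
    (hGF o ho hodd).trans (hle.trans (by linarith [hFG e he hev]))⟩

/-- **WALL (ORDER BIT, PROVED, RH-free, binder-free)**: "the bottom of the window is even", required on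
ANY set of cutoffs `S`, does not discriminate `ζ` from a negative class containing the
non-Weil-positive data (the planted real pole pair passes it whenever `ζ` does). [folklore] -/
theorem no_evenBottom_discriminator (S : Set ℝ) {Neg : Set ExplicitDatum}
    (hNeg : {F : ExplicitDatum | ¬ F.Positivity} ⊆ Neg) :
    ¬ Discriminates (fun F ↦ ∀ A ∈ S, F.EvenBottomOn A) zetaDatum Neg :=
  no_evenDownOddUp_discriminator
    (IsEvenDownOddUpMonotone.all fun A ↦ IsEvenDownOddUpMonotone.all fun _ ↦
      evenBottomOn_isEvenDownOddUpMonotone A) hNeg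

/-- The same for the strict order bit. [folklore] -/
theorem no_evenStrictBottom_discriminator (S : Set ℝ) {Neg : Set ExplicitDatum}
    (hNeg : {F : ExplicitDatum | ¬ F.Positivity} ⊆ Neg) :
    ¬ Discriminates (fun F ↦ ∀ A ∈ S, F.EvenStrictBottomOn A) zetaDatum Neg :=
  no_evenDownOddUp_discriminator
    (IsEvenDownOddUpMonotone.all fun A ↦ IsEvenDownOddUpMonotone.all fun _ ↦
      evenStrictBottomOn_isEvenDownOddUpMonotone A) hNeg

/-- **WALL (ODD FLOORS)**: cutoff-dependent odd floors `ε₁^odd(A) ≥ σ(A)` on any set of cutoffs. [folklore] -/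
theorem no_oddFloor_discriminator (σ : ℝ → ℝ) (S : Set ℝ) {Neg : Set ExplicitDatum}
    (hNeg : {F : ExplicitDatum | ¬ F.Positivity} ⊆ Neg) :
    ¬ Discriminates (fun F ↦ ∀ A ∈ S, F.OddFloorOn (σ A) A) zetaDatum Neg :=
  no_oddMonotone_discriminator (P := fun F ↦ ∀ A ∈ S, F.OddFloorOn (σ A) A)
    (fun F G hFG hF A hA ↦ oddFloorOn_isOddMonotone (σ A) A F G hFG (hF A hA)) hNeg

/-- **WALL (EVEN LEVEL ABOVE ODD GROUND)**: cutoff-dependent codimension, any set of cutoffs. [folklore] -/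
theorem no_evenAboveOddGround_discriminator (k : ℝ → ℕ) (S : Set ℝ) {Neg : Set ExplicitDatum}
    (hNeg : {F : ExplicitDatum | ¬ F.Positivity} ⊆ Neg) :
    ¬ Discriminates (fun F ↦ ∀ A ∈ S, F.EvenAboveOddGroundOn (k A) A) zetaDatum Neg :=
  no_evenUpOddDown_discriminator
    (IsEvenUpOddDownMonotone.all fun A ↦ IsEvenUpOddDownMonotone.all fun _ ↦
      evenAboveOddGroundOn_isEvenUpOddDownMonotone (k A) A) hNeg

end Summit.RiemannHypothesis.RiemannHypothesis.Theorems.PfPersistenceBarrier
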